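import Mathlib
import HarnessLib
import Literature.Computability.AlgebraicComplexity.PatternExpressions
import Literature.Computability.AlgebraicComplexity.BlaserJindalSymmetricProofs
import Literature.Computability.AlgebraicComplexity.EsymmWitnessDegree
import Literature.Computability.AlgebraicComplexity.QPBoundedClosure
import Literature.Computability.AlgebraicComplexity.ValiantClassesProofs
import Summits.ValiantsHypothesis.ValiantsHypothesis.Theorems.MonotoneRestorationOrbitCompressionQPEsymmSubstitution

/-!
# Route MonotoneRestoration — aside `OrbitCompressionQP` (stmt-ValiantsHypothesis-18332), line
# `expression_compression`: the ONE-ROW STRATUM of `stub_narrowExpressionCompression`, UNCONDITIONALLY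

`R1` of the repair census of hand `-3 g1` (REQUESTS.md, 2026-08-31): "one-row stratum
`f_n = Σ_i g_n(row i)`, `g_n` symmetric `VP` — TRUE IN PRINT modulo typing: Bläser–Jindal ITCS 2019 Thm 4 +
circuit→formula balancing (VSBR/Hyafil) + glue".  All three inputs are in the tree and PROVED:
Bläser–Jindal's Theorem 4 in polynomial form (`BlaserJindal2019_thm4_holds`, with the degree lemma
`totalDegree_le_totalDegree_aeval_esymm`), `VQP_e = VQP` (BCS (21.33), `isVQPeFamily_iff_isVQPFamily`), and
the glue of this line (`FormulaSubstitution.narrowQP_oneRow_of_symmetricCore`: Newton substituends with open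
labels + the `VQP` substitution principle).  Hence:

* `isVQPFamily_symmetricCore` — the symmetric cores `P_n` (`P_n(e_1, …, e_n) = g_n`) of a `VQP` family of
  symmetric polynomials form a `VQP` family (Bläser–Jindal at the quasi-polynomial scale);
* ★★ `narrowQP_oneRow` — for every family `g_n ∈ ℂ[x_0, …, x_{n-1}]^{S_n}` in `VQP` (in particular in
  `VP`, `narrowQP_oneRow_of_VP`), the matrix-symmetric family `f_n = Σ_i g_n(x_{i,0}, …, x_{i,n-1})`
  satisfies the conclusion of `stub_narrowExpressionCompression`: it is the closed polynomial of a
  `(1,1)`-label pattern expression of quasi-polynomial length.  This is the first stratum of the open stub in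
  which the COMPLEXITY half of the `VP` hypothesis is what makes compression work (the hypothesis
  "narrow of some length" is automatic here and not used).

Helper file (`--supports stmt-ValiantsHypothesis-18332`); def-free; nothing here is a named fact; no registered
stub is closed (stub 1 is refuted as registered, stub 2 is the open aside); VP ≠ VNP is not moved.
-/

noncomputable section

open MvPolynomial

-- `Summit.ValiantsHypothesis.ValiantsHypothesis.…` is the tree's single-conjunct layout (Sub = Summit).
set_option linter.dupNamespace false

namespace Summit.ValiantsHypothesis.ValiantsHypothesis.Theorems

namespace FormulaSubstitution

open Literature.Computability.AlgebraicComplexity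

/-- **Symmetric cores of a `VQP` family form a `VQP` family** (Bläser–Jindal 2019, Thm 4, polynomial form,
proved in the tree: `L(P) ≤ (L(P_Sym) + deg P_Sym + n + 2)^c`; degree lemma `deg P ≤ deg P_Sym`).
[cite: BlaserJindal2019, Thm. 4 and Remark (p. 47:3)] -/
theorem isVQPFamily_symmetricCore (g P : (n : ℕ) → MvPolynomial (Fin n) ℂ)
    (hP : ∀ n, aeval (fun j : Fin n => esymm (Fin n) ℂ (j.val + 1)) (P n) = g n)
    (hg : IsVQPFamily g) : IsVQPFamily P := by
  obtain ⟨⟨_, hdeg⟩, hL⟩ := hg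
  obtain ⟨c, hc⟩ := BlaserJindal2019_thm4_holds
  refine ⟨⟨?_, ?_⟩, ?_⟩
  · exact IsPBounded.id.mono fun n => by simp
  · refine hdeg.mono fun n => ?_
    rw [← hP n]
    exact totalDegree_le_totalDegree_aeval_esymm (P n)
  · have hq : IsQPBounded fun n => (complexity (g n) + (g n).totalDegree + n + 2) ^ c :=
      (((hL.add hdeg.isQPBounded).add IsPBounded.id.isQPBounded).add (IsQPBounded.const 2)).pow c
    refine hq.mono fun n => ?_
    have h := hc n (P n)
    rw [hP n] at h
    exact h

/-- ★★ **The one-row stratum is narrow of quasi-polynomial length.**  For every `VQP` family of SYMMETRIC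
polynomials `g_n ∈ ℂ[x_0, …, x_{n-1}]`, the family `f_n = Σ_i g_n(x_{i,0}, …, x_{i,n-1})` on the `n × n`
variable matrix is the closed polynomial of a `(1,1)`-label pattern expression of quasi-polynomial length,
uniformly in `n ≥ 1` — the conclusion of `stub_narrowExpressionCompression` on this stratum.
[cite: BlaserJindal2019, Thm. 4] -/
theorem narrowQP_oneRow (g : (n : ℕ) → MvPolynomial (Fin n) ℂ) (hsymm : ∀ n, (g n).IsSymmetric)
    (hg : IsVQPFamily g) :
    ∃ c : ℕ, ∀ n : ℕ, 1 ≤ n → ∃ (k l : ℕ) (e : PatternExpr ℂ k l),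
      n ^ (k + l) ≤ 2 ^ ((Nat.log 2 n + c) ^ c) ∧ e.length ≤ 2 ^ ((Nat.log 2 n + c) ^ c) ∧
      e.close n = ∑ i : Fin n,
        aeval (fun v : Fin n => (X (i, v) : MvPolynomial (Fin n × Fin n) ℂ)) (g n) := by
  choose P hP using fun n => exists_symmetricCore (g n) (hsymm n)
  exact narrowQP_oneRow_of_symmetricCore g P hP (isVQPFamily_symmetricCore g P hP hg)

/-- The `VP` case of `narrowQP_oneRow` (`VP ⊆ VQP`). [cite: BlaserJindal2019, Thm. 4] -/
theorem narrowQP_oneRow_of_VP (g : (n : ℕ) → MvPolynomial (Fin n) ℂ) (hsymm : ∀ n, (g n).IsSymmetric)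
    (hg : IsVPFamily g) :
    ∃ c : ℕ, ∀ n : ℕ, 1 ≤ n → ∃ (k l : ℕ) (e : PatternExpr ℂ k l),
      n ^ (k + l) ≤ 2 ^ ((Nat.log 2 n + c) ^ c) ∧ e.length ≤ 2 ^ ((Nat.log 2 n + c) ^ c) ∧
      e.close n = ∑ i : Fin n,
        aeval (fun v : Fin n => (X (i, v) : MvPolynomial (Fin n × Fin n) ℂ)) (g n) :=
  narrowQP_oneRow g hsymm hg.isVQPFamily

/-- **The one-row stratum is matrix-symmetric** (so it lies in the scope of the stub): independent row and
column permutations fix `Σ_i g_n(row i)` when `g_n` is symmetric. [folklore] -/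
theorem oneRow_matrixSymmetric {n : ℕ} (g : MvPolynomial (Fin n) ℂ) (hsymm : g.IsSymmetric)
    (σ τ : Equiv.Perm (Fin n)) :
    rename (fun p : Fin n × Fin n => (σ p.1, τ p.2))
      (∑ i : Fin n, aeval (fun v : Fin n => (X (i, v) : MvPolynomial (Fin n × Fin n) ℂ)) g) =
      ∑ i : Fin n, aeval (fun v : Fin n => (X (i, v) : MvPolynomial (Fin n × Fin n) ℂ)) g := by
  rw [map_sum]
  have hterm : ∀ i : Fin n, rename (fun p : Fin n × Fin n => (σ p.1, τ p.2))
      (aeval (fun v : Fin n => (X (i, v) : MvPolynomial (Fin n × Fin n) ℂ)) g) =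
      aeval (fun v : Fin n => (X (σ i, v) : MvPolynomial (Fin n × Fin n) ℂ)) g := by
    intro i
    calc rename (fun p : Fin n × Fin n => (σ p.1, τ p.2))
          (aeval (fun v : Fin n => (X (i, v) : MvPolynomial (Fin n × Fin n) ℂ)) g)
          = aeval (fun v : Fin n => (X (σ i, τ v) : MvPolynomial (Fin n × Fin n) ℂ)) g := by
            rw [← AlgHom.comp_apply, comp_aeval]
            simp only [rename_X]
      _ = aeval (fun v : Fin n => (X (σ i, v) : MvPolynomial (Fin n × Fin n) ℂ)) (rename τ g) := by
            rw [aeval_rename]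
            rfl
      _ = _ := by rw [hsymm τ]
  simp_rw [hterm]
  exact Fintype.sum_equiv σ _ _ fun i => rfl

end FormulaSubstitution

end Summit.ValiantsHypothesis.ValiantsHypothesis.Theorems

end
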